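/-
Copyright (c) 2026 the pub-hodgecm-mathlib formalisation cell (harness21).  Prover seat hodgecm-mathlib-K2E1-p12 (g7), Track B ∕ R90-TF, h413 = `stmt-HodgeConjecture-24833`,
R90-TF section S8 «ContSpec-n½», socket (E) :276, E1-PLANCHEREL BODY brick PB-2 (S8 dealer R90-CS-plan (g4) S8-R254 (8)+(13), S8-R263 (1)): three of the five instantiation letters of ★
PB-2b∕2c `K2E1PseudoEisensteinTwoTermGramAxisGeneric` DISCHARGED generically — axis unitarity `hc1` from the functional equation and adjoint reflection, the integrability letter `hG` from
★ PB-2a′'s entry letters, and the `L²((0,∞); V)` representatives `hw` from the Mellin decay of `C²_c` profiles — pure analysis, on letters.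
-/
import Summits.HodgeConjecture.HodgeConjecture.Theorems.K2E1PseudoEisensteinContourShiftVectorAxisGeneric   -- ★ PB-2a′ (this seat): `integrable_vectorIntegrand_vertical_axis`, `axis_conj_sub_two_mul`; brings ★ PB-2a, ★ T4b §1 Mellin bounds, ★ T4a `integrable_of_continuous_of_sq_decay`, ★ A
import Mathlib.MeasureTheory.Function.L2Space
import HarnessLib

/-!
# PB-2 letters — `K2E1PseudoEisensteinTwoTermGramLettersAxisGeneric`: the letters `hc1` (axis unitarity), `hG` (integrable axis integrands) and `hw` (`L²` representatives of the
# continuous model) of ★ `K2E1PseudoEisensteinTwoTermGramAxisGeneric.exists_linearIsometry_of_contourShift` ∕ `twoTerm_gram_inner_Lp_of_contourShift`, discharged on smaller letters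

Track B ∕ R90-TF, crux h413 = `stmt-HodgeConjecture-24833`, route of record `HCCMUnconditional`; cell `hodgecm-mathlib`, R90-TF programme, section S8 «ContSpec-n½», socket (E)
(B ED. 7 :276): the E1-PLANCHEREL BODY at the τ-cut block, bricks PB-1…PB-4 (S8-R254).  THEOREMS ONLY (no `def`, no `instance`, no `notation`, no named-fact hypothesis, no `sorry`;
default heartbeats); lane `--supports stmt-HodgeConjecture-24833 --as helper` (count-neutral).  No automorphic object.  CLOSES NO SOCKET.

THE MATHEMATICS ([MoeglinWaldspurger1995, II.2.2, IV.1.10–IV.1.11, IV.3.12]; [Langlands1976, §7]; [Titchmarsh1948, §1.29]).  ★ PB-2b∕2c turns the contour-shifted two-term formula into the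
Gram letter and the `⊕`-isometry under five instantiation letters `hIP, hR, hc1∕hcs, hG, hw`.  Three of them are formal consequences of smaller ones.  (§1) On the unitary axis `z = κ+it`
the reflection `2κ − z̄`… more precisely `2κ − z = z̄ = κ − it`, so the FUNCTIONAL EQUATION `M(2κ − z)M(z) = 1` ([MW IV.1.10]) reads **(hFE)** `M(κ−it) ∘ M(κ+it) = id`, and the ADJOINT
RELATION `M(z)† = M(z̄)` ([MW IV.1.10 (b)], for the `K`-invariant pairing) reads **(hcs)** `⟪u, M(κ+it)v⟫ = ⟪M(κ−it)u, v⟫`; together `⟪M(z)u, M(z)v⟫ = ⟪M(z̄)M(z)u, v⟫ = ⟪u, v⟫` = **(hc1)**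
(`hc1_of_functionalEquation`).  (§2) For transforms `Φ_i(w) = Σ_a f̃_{i,a}(w)•φ_{i,a}` of finite sums of pure tensors (`f_{i,a} ∈ C²_c((0,∞))`) the axis integrand
`⟪Φ_i(−z), Φ_j(−z)⟫ + ⟪Φ_i(−z̄), M(z)Φ_j(−z)⟫` at `z = κ+it` is `L¹(ℝ)` by ★ PB-2a′ `integrable_vectorIntegrand_vertical_axis` at `σ = κ`, `ρ = 2κ` (the entry letters `hs∕hB` at the pair
`(i, j)`; `z̄ − 2κ = −z`, `−z̄ = −(κ + i(−t))`) = **(hG)** (`integrable_axisIntegrand_of_entryLetters`).  (§3) `t ↦ Φ_i(−(κ+it))` is continuous and `O(t⁻²)` (★ T4b §1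
`exists_norm_mellin_vertical_le_div_sq_of_mem_Icc`), so if `M` is CONTINUOUS along the axis on vectors **(hMc)** and CONTRACTIVE there **(hM1)** `‖M(κ+it)v‖ ≤ ‖v‖` (⇐ hc1), the model
function `U_i(t) = Φ_i(−(κ+it)) + M(κ−it)Φ_i(−(κ−it))` is continuous with `‖U_i(t)‖² ≤ 4K²∕t²` for `|t| ≥ 1`, hence in `L²(ℝ; V)` and in `L²((0,∞); V)` — its class `w_i` satisfies **(hw)**
(`memLp_two_axisModel`, `exists_axisModel_representatives`).  AFTER THIS FILE the letters of ★ `exists_linearIsometry_of_contourShift` ∕ `twoTerm_gram_inner_Lp_of_contourShift` at a τ-cut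
block read: `hIP` (★ PB-2a′ on `hs∕hr∕hB` per entry + PB-1), `hR` (residue positivity), `hFE` + `hcs` (functional equation + adjoint reflection of `M(w₀,·)|_V` on `Re z = κ`), `hMc`.
* §1 **`hc1_of_functionalEquation`**.  * §2 **`integrable_axisIntegrand_of_entryLetters`**.
* §3 `continuous_transform_axis`, `exists_norm_transform_axis_le_div_sq`, `continuous_axisModel`, **`memLp_two_axisModel`**, **`exists_axisModel_representatives`**.
HONEST LABEL: HC_CM is proved only modulo the 7 printed citations (2 remaining named inputs: hLiu418 = `stmt-HodgeConjecture-24832`, h413 = `stmt-HodgeConjecture-24833`) until rung 0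
closes; this file asserts no named fact, closes no socket; count-neutral; `hFE`, `hcs`, `hMc`, `hM1`, `hs∕hB` are hypotheses (Maass–Selberg ∕ T-estate currency at N = 3), not claims.

## References
* [MoeglinWaldspurger1995] C. Mœglin, J.-L. Waldspurger, *Spectral decomposition and Eisenstein series* (1995), II.2.2, IV.1.10–IV.1.11, IV.3.12.
* [Langlands1976] R. P. Langlands, *On the Functional Equations Satisfied by Eisenstein Series*, LNM 544 (1976), §7.
* [Titchmarsh1948] E. C. Titchmarsh, *Introduction to the Theory of Fourier Integrals* (1948), §1.29.
-/

set_option autoImplicit false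
set_option linter.dupNamespace false  -- the mandated namespace repeats the summit's segment (`HodgeConjecture.HodgeConjecture`)

noncomputable section

open MeasureTheory Measure Set Filter Topology Complex
open scoped Real ComplexConjugate InnerProductSpace BigOperators
open Summit.HodgeConjecture.HodgeConjecture.Cruxes.H413.K2E1MellinPaleyWienerHalfLine (differentiable_mellin conj_vertical)
open Summit.HodgeConjecture.HodgeConjecture.Cruxes.H413.K2E1VerticalLineContourShift (integrable_of_continuous_of_sq_decay)
open Summit.HodgeConjecture.HodgeConjecture.Cruxes.H413.K2E1PseudoEisensteinContourShiftCMTwo (exists_norm_mellin_vertical_le_div_sq_of_mem_Icc)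
open Summit.HodgeConjecture.HodgeConjecture.Cruxes.H413.K2E1PseudoEisensteinContourShiftVectorAxisGeneric (integrable_vectorIntegrand_vertical_axis axis_conj_sub_two_mul)

namespace Summit.HodgeConjecture.HodgeConjecture.Cruxes.H413.K2E1PseudoEisensteinTwoTermGramLettersAxisGeneric

variable {V : Type*} [NormedAddCommGroup V] [InnerProductSpace ℂ V]

/-! ## §1 `hc1` (axis unitarity) from the functional equation and the adjoint reflection -/

/-- **AXIS UNITARITY FROM THE FUNCTIONAL EQUATION AND THE ADJOINT REFLECTION.**  If on the axis `z = κ+it` the operator datum satisfies **(hFE)** `M(κ−it)(M(κ+it)v) = v` (the functional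
equation `M(2κ − z)M(z) = 1` at `2κ − z = z̄`) and **(hcs)** `⟪u, M(κ+it)v⟫ = ⟪M(κ−it)u, v⟫` (`M(z)† = M(z̄)`), then **(hc1)** `⟪M(κ+it)u, M(κ+it)v⟫ = ⟪u, v⟫` — the `hc1` letter of ★
`K2E1PseudoEisensteinTwoTermGramAxisGeneric.exists_linearIsometry_of_contourShift`, in its spelling `M(κ + i(−t))`. [cite: MoeglinWaldspurger1995, IV.1.10] [cite: Langlands1976, §7] -/
theorem hc1_of_functionalEquation (M : ℂ → V →ₗ[ℂ] V) (κ : ℝ)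
    (hFE : ∀ (t : ℝ) (v : V), M ((κ : ℂ) + ((-t : ℝ) : ℂ) * I) (M ((κ : ℂ) + t * I) v) = v)
    (hcs : ∀ (t : ℝ) (u v : V), ⟪u, M ((κ : ℂ) + t * I) v⟫_ℂ = ⟪M ((κ : ℂ) + ((-t : ℝ) : ℂ) * I) u, v⟫_ℂ) (t : ℝ) (u v : V) :
    ⟪M ((κ : ℂ) + t * I) u, M ((κ : ℂ) + t * I) v⟫_ℂ = ⟪u, v⟫_ℂ := by
  rw [hcs t (M ((κ : ℂ) + t * I) u) v, hFE t u]

/-! ## §2 `hG` (integrable axis integrands) from ★ PB-2a′'s entry letters -/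

/-- **THE AXIS INTEGRANDS ARE `L¹(ℝ)`** for transforms of finite sums of pure tensors `Φ_i(w) = Σ_a f̃_{i,a}(w)•φ_{i,a}` (`f_{i,a} ∈ C²_c((0,∞))`, common finite index type `α`): given, AT THE
PAIR `(i, j)`, ★ PB-2a′'s entry letters on an open `U ⊇ {κ ≤ Re z ≤ σ₀}` off a finset `S ⊂ (κ, ∞)` — `hs` holomorphy of `z ↦ ⟪φ_{i,b}, M(z)φ_{j,a}⟫` on `U ∖ S`, `hB` the strip bound at
`|Im z| ≥ 1` — the function `t ↦ ⟪Φ_i(−(κ+it)), Φ_j(−(κ+it))⟫ + ⟪Φ_i(−(κ+i(−t))), M(κ+it)Φ_j(−(κ+it))⟫` is integrable: ★ `integrable_vectorIntegrand_vertical_axis` at `σ = κ`, `ρ = 2κ`, read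
through `z̄ − 2κ = −z` (★ `axis_conj_sub_two_mul`) and `−z̄ = −(κ + i(−t))` (★ A `conj_vertical`) — the `hG` letter of ★ PB-2b∕2c, byte for byte. [cite: MoeglinWaldspurger1995, II.2.2] -/
theorem integrable_axisIntegrand_of_entryLetters {ι α : Type*} [Fintype α] (f : ι → α → ℝ → ℂ) (φ : ι → α → V)
    (hf : ∀ i a, ContDiff ℝ 2 (f i a)) (hfs : ∀ i a, HasCompactSupport (f i a)) (hf0 : ∀ i a, tsupport (f i a) ⊆ Ioi 0)
    (M : ℂ → V →ₗ[ℂ] V) {κ σ₀ : ℝ} (hσ₀ : κ < σ₀) {U : Set ℂ} (hUo : IsOpen U) (hUs : {z : ℂ | κ ≤ z.re ∧ z.re ≤ σ₀} ⊆ U) (S : Finset ℝ) (hS : ∀ c ∈ S, κ < c) (i j : ι)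
    (hs : ∀ a b, DifferentiableOn ℂ (fun z : ℂ => ⟪φ i b, M z (φ j a)⟫_ℂ) (U \ ((S.image fun c : ℝ => (c : ℂ)) : Set ℂ)))
    {B : ℝ} (hB : ∀ a b, ∀ z : ℂ, κ < z.re → z.re ≤ σ₀ → 1 ≤ |z.im| → ‖⟪φ i b, M z (φ j a)⟫_ℂ‖ ≤ B) :
    Integrable fun t : ℝ => ⟪∑ b, mellin (f i b) (-((κ : ℂ) + t * I)) • φ i b, ∑ a, mellin (f j a) (-((κ : ℂ) + t * I)) • φ j a⟫_ℂ +
      ⟪∑ b, mellin (f i b) (-((κ : ℂ) + ((-t : ℝ) : ℂ) * I)) • φ i b, M ((κ : ℂ) + t * I) (∑ a, mellin (f j a) (-((κ : ℂ) + t * I)) • φ j a)⟫_ℂ := by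
  have h := integrable_vectorIntegrand_vertical_axis (hf j) (hfs j) (hf0 j) (hf i) (hfs i) (hf0 i) hσ₀ (2 * (κ : ℂ)) (φ j) (φ i) M hUo hUs S hS hs hB
    (le_refl κ) hσ₀.le (fun c hc => (hS c hc).ne)
  refine h.congr (Eventually.of_forall fun t => ?_)
  simp only [axis_conj_sub_two_mul]
  simp only [conj_vertical]

/-! ## §3 `hw` (`L²((0,∞); V)` representatives of the continuous model) from the Mellin decay -/

section Model

variable {α : Type*} [Fintype α]

/-- `t ↦ Φ(−(κ+it)) = Σ_a f̃_a(−(κ+it))•φ_a` is continuous (★ A `differentiable_mellin`). [cite: Titchmarsh1948, §1.29] -/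
theorem continuous_transform_axis (f : α → ℝ → ℂ) (φ : α → V) (hf : ∀ a, ContDiff ℝ 2 (f a)) (hfs : ∀ a, HasCompactSupport (f a)) (hf0 : ∀ a, tsupport (f a) ⊆ Ioi 0) (κ : ℝ) :
    Continuous fun t : ℝ => ∑ a, mellin (f a) (-((κ : ℂ) + t * I)) • φ a := by
  refine continuous_finsetSum _ fun a _ => ?_
  have hL : Continuous fun t : ℝ => -((κ : ℂ) + t * I) := (continuous_const.add (continuous_ofReal.mul continuous_const)).neg
  exact (((differentiable_mellin (hf a).continuous (hfs a) (hf0 a)).continuous).comp hL).smul continuous_const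

/-- **`O(t⁻²)` OF THE TRANSFORM ON THE AXIS**: `∃ K, ‖Φ(−(κ+it))‖ ≤ K∕t²` for `t ≠ 0` (★ T4b §1 `exists_norm_mellin_vertical_le_div_sq_of_mem_Icc` per profile at `Re = −κ`, summed).
[cite: Titchmarsh1948, §1.29] -/
theorem exists_norm_transform_axis_le_div_sq (f : α → ℝ → ℂ) (φ : α → V) (hf : ∀ a, ContDiff ℝ 2 (f a)) (hfs : ∀ a, HasCompactSupport (f a)) (hf0 : ∀ a, tsupport (f a) ⊆ Ioi 0)
    (κ : ℝ) : ∃ K : ℝ, ∀ t : ℝ, t ≠ 0 → ‖∑ a, mellin (f a) (-((κ : ℂ) + t * I)) • φ a‖ ≤ K / t ^ 2 := by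
  have hB : ∀ a, ∃ B : ℝ, 0 ≤ B ∧ ∀ σ ∈ Icc (-κ) (-κ), ∀ y : ℝ, y ≠ 0 → ‖mellin (f a) ((σ : ℂ) + y * I)‖ ≤ B / y ^ 2 := fun a =>
    exists_norm_mellin_vertical_le_div_sq_of_mem_Icc (hf a) (hfs a) (hf0 a) (-κ) (-κ)
  choose B hB0 hB using hB
  refine ⟨∑ a, B a * ‖φ a‖, fun t ht => ?_⟩
  have e1 : -((κ : ℂ) + t * I) = ((-κ : ℝ) : ℂ) + ((-t : ℝ) : ℂ) * I := by push_cast; ring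
  rw [e1, Finset.sum_div]
  refine (norm_sum_le _ _).trans (Finset.sum_le_sum fun a _ => ?_)
  rw [norm_smul]
  have h := hB a (-κ) ⟨le_rfl, le_rfl⟩ (-t) (neg_ne_zero.2 ht)
  rw [neg_sq] at h
  calc ‖mellin (f a) (((-κ : ℝ) : ℂ) + ((-t : ℝ) : ℂ) * I)‖ * ‖φ a‖ ≤ B a / t ^ 2 * ‖φ a‖ := mul_le_mul_of_nonneg_right h (norm_nonneg _)
    _ = B a * ‖φ a‖ / t ^ 2 := by ring

/-- **THE CONTINUOUS MODEL FUNCTION IS CONTINUOUS**: `t ↦ U(t) = Φ(−(κ+it)) + M(κ−it)Φ(−(κ−it))` is continuous when `M` is continuous along the axis on vectors **(hMc)** (linearity of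
`M(z)` moves it inside the finite sum). [cite: MoeglinWaldspurger1995, IV.1.11] -/
theorem continuous_axisModel (f : α → ℝ → ℂ) (φ : α → V) (hf : ∀ a, ContDiff ℝ 2 (f a)) (hfs : ∀ a, HasCompactSupport (f a)) (hf0 : ∀ a, tsupport (f a) ⊆ Ioi 0)
    (M : ℂ → V →ₗ[ℂ] V) (κ : ℝ) (hMc : ∀ v : V, Continuous fun t : ℝ => M ((κ : ℂ) + t * I) v) :
    Continuous fun t : ℝ => (∑ a, mellin (f a) (-((κ : ℂ) + t * I)) • φ a) +
      M ((κ : ℂ) + ((-t : ℝ) : ℂ) * I) (∑ a, mellin (f a) (-((κ : ℂ) + ((-t : ℝ) : ℂ) * I)) • φ a) := by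
  refine (continuous_transform_axis f φ hf hfs hf0 κ).add ?_
  have e : (fun t : ℝ => M ((κ : ℂ) + ((-t : ℝ) : ℂ) * I) (∑ a, mellin (f a) (-((κ : ℂ) + ((-t : ℝ) : ℂ) * I)) • φ a)) =
      fun t : ℝ => ∑ a, mellin (f a) (-((κ : ℂ) + ((-t : ℝ) : ℂ) * I)) • M ((κ : ℂ) + ((-t : ℝ) : ℂ) * I) (φ a) := by
    funext t
    rw [_root_.map_sum]
    exact Finset.sum_congr rfl fun a _ => map_smul _ _ _
  rw [e]
  refine continuous_finsetSum _ fun a _ => ?_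
  have hL : Continuous fun t : ℝ => -((κ : ℂ) + ((-t : ℝ) : ℂ) * I) := (continuous_const.add ((continuous_ofReal.comp continuous_neg).mul continuous_const)).neg
  exact (((differentiable_mellin (hf a).continuous (hfs a) (hf0 a)).continuous).comp hL).smul ((hMc (φ a)).comp continuous_neg)

/-- **THE CONTINUOUS MODEL FUNCTION IS IN `L²`**: with **(hMc)** and the axis contraction **(hM1)** `‖M(κ+it)v‖ ≤ ‖v‖` (⇐ unitarity hc1), `U(t) = Φ(−(κ+it)) + M(κ−it)Φ(−(κ−it))` is
continuous with `‖U(t)‖² ≤ 4K²∕t²` for `|t| ≥ 1` (§3 decay, `t⁴ ≥ t²`), hence `MemLp U 2` for Lebesgue measure on `ℝ` (★ T4a `integrable_of_continuous_of_sq_decay` on `‖U‖²`, Mathlib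
`memLp_two_iff_integrable_sq_norm`) and on `(0,∞)` by restriction. [cite: MoeglinWaldspurger1995, II.2.2, IV.3.12] [cite: Titchmarsh1948, §1.29] -/
theorem memLp_two_axisModel (f : α → ℝ → ℂ) (φ : α → V) (hf : ∀ a, ContDiff ℝ 2 (f a)) (hfs : ∀ a, HasCompactSupport (f a)) (hf0 : ∀ a, tsupport (f a) ⊆ Ioi 0)
    (M : ℂ → V →ₗ[ℂ] V) (κ : ℝ) (hMc : ∀ v : V, Continuous fun t : ℝ => M ((κ : ℂ) + t * I) v) (hM1 : ∀ (t : ℝ) (v : V), ‖M ((κ : ℂ) + t * I) v‖ ≤ ‖v‖) :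
    MemLp (fun t : ℝ => (∑ a, mellin (f a) (-((κ : ℂ) + t * I)) • φ a) +
      M ((κ : ℂ) + ((-t : ℝ) : ℂ) * I) (∑ a, mellin (f a) (-((κ : ℂ) + ((-t : ℝ) : ℂ) * I)) • φ a)) 2 ((volume : Measure ℝ).restrict (Ioi 0)) := by
  have hcont := continuous_axisModel f φ hf hfs hf0 M κ hMc
  obtain ⟨K, hK⟩ := exists_norm_transform_axis_le_div_sq f φ hf hfs hf0 κ
  set g : ℝ → V := fun t : ℝ => (∑ a, mellin (f a) (-((κ : ℂ) + t * I)) • φ a) +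
      M ((κ : ℂ) + ((-t : ℝ) : ℂ) * I) (∑ a, mellin (f a) (-((κ : ℂ) + ((-t : ℝ) : ℂ) * I)) • φ a) with hg
  refine MemLp.restrict (Ioi 0) ((memLp_two_iff_integrable_sq_norm hcont.aestronglyMeasurable).2 ?_)
  -- `‖U(t)‖²` is continuous with `‖U(t)‖² ≤ (2K∕t²)² ≤ 4K²∕t²` for `|t| ≥ 1`; integrate the complex-valued copy (★ T4a) and take real parts
  have hgt : ∀ t : ℝ, ‖g t‖ ≤ ‖∑ a, mellin (f a) (-((κ : ℂ) + t * I)) • φ a‖ + ‖M ((κ : ℂ) + ((-t : ℝ) : ℂ) * I) (∑ a, mellin (f a) (-((κ : ℂ) + ((-t : ℝ) : ℂ) * I)) • φ a)‖ :=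
    fun t => norm_add_le _ _
  have hsq : Continuous fun t : ℝ => ((‖g t‖ ^ 2 : ℝ) : ℂ) := continuous_ofReal.comp (hcont.norm.pow 2)
  have hdec : ∀ t : ℝ, 1 ≤ |t| → ‖((‖g t‖ ^ 2 : ℝ) : ℂ)‖ ≤ (4 * K ^ 2) / t ^ 2 := by
    intro t ht
    have ht0 : t ≠ 0 := fun h => by rw [h, abs_zero] at ht; linarith
    have ht2 : 1 ≤ t ^ 2 := by nlinarith [abs_nonneg t, sq_abs t]
    have hA : ‖∑ a, mellin (f a) (-((κ : ℂ) + t * I)) • φ a‖ ≤ K / t ^ 2 := hK t ht0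
    have hA' : ‖M ((κ : ℂ) + ((-t : ℝ) : ℂ) * I) (∑ a, mellin (f a) (-((κ : ℂ) + ((-t : ℝ) : ℂ) * I)) • φ a)‖ ≤ K / t ^ 2 := by
      refine (hM1 (-t) _).trans ?_
      have h := hK (-t) (neg_ne_zero.2 ht0)
      rwa [neg_sq] at h
    have hU : ‖g t‖ ≤ 2 * (K / t ^ 2) := (hgt t).trans (by linarith)
    have hpos : 0 < t ^ 2 := by positivity
    rw [Complex.norm_real, Real.norm_eq_abs, abs_of_nonneg (by positivity)]
    calc ‖g t‖ ^ 2 ≤ (2 * (K / t ^ 2)) ^ 2 := pow_le_pow_left₀ (norm_nonneg _) hU 2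
      _ = (4 * K ^ 2) / t ^ 2 * (1 / t ^ 2) := by field_simp; ring
      _ ≤ (4 * K ^ 2) / t ^ 2 * 1 := by
          refine mul_le_mul_of_nonneg_left ?_ (by positivity)
          rw [div_le_one hpos]; exact ht2
      _ = (4 * K ^ 2) / t ^ 2 := mul_one _
  have hint := (integrable_of_continuous_of_sq_decay hsq hdec).re
  refine hint.congr (Eventually.of_forall fun t => ?_)
  simp only [RCLike.re_to_complex, ofReal_re]

/-- **`hw` — `L²((0,∞); V)` REPRESENTATIVES OF THE CONTINUOUS MODEL EXIST**: for a family of transforms `Φ_i(w) = Σ_a f̃_{i,a}(w)•φ_{i,a}` (`f_{i,a} ∈ C²_c((0,∞))`) and an operator datum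
continuous **(hMc)** and contractive **(hM1)** along the axis `Re z = κ`, there are `w_i ∈ L²((0,∞); V)` with `w_i =ᵐ U_i`, `U_i(t) = Φ_i(−(κ+it)) + M(κ−it)Φ_i(−(κ−it))` — the `hw` letter of
★ `exists_linearIsometry_of_contourShift` ∕ `twoTerm_gram_inner_Lp_of_contourShift` at `Φ i := fun w => Σ_a mellin (f i a) w • φ i a`, byte for byte (`w_i := (memLp_two_axisModel …).toLp`).
[cite: MoeglinWaldspurger1995, II.2.4, IV.3.12] -/
theorem exists_axisModel_representatives {ι : Type*} (f : ι → α → ℝ → ℂ) (φ : ι → α → V)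
    (hf : ∀ i a, ContDiff ℝ 2 (f i a)) (hfs : ∀ i a, HasCompactSupport (f i a)) (hf0 : ∀ i a, tsupport (f i a) ⊆ Ioi 0)
    (M : ℂ → V →ₗ[ℂ] V) (κ : ℝ) (hMc : ∀ v : V, Continuous fun t : ℝ => M ((κ : ℂ) + t * I) v) (hM1 : ∀ (t : ℝ) (v : V), ‖M ((κ : ℂ) + t * I) v‖ ≤ ‖v‖) :
    ∃ w : ι → Lp V 2 ((volume : Measure ℝ).restrict (Ioi 0)),
      ∀ i, (w i : ℝ → V) =ᵐ[(volume : Measure ℝ).restrict (Ioi 0)] fun t =>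
        (fun w : ℂ => ∑ a, mellin (f i a) w • φ i a) (-((κ : ℂ) + t * I)) +
          M ((κ : ℂ) + ((-t : ℝ) : ℂ) * I) ((fun w : ℂ => ∑ a, mellin (f i a) w • φ i a) (-((κ : ℂ) + ((-t : ℝ) : ℂ) * I))) :=
  ⟨fun i => (memLp_two_axisModel (f i) (φ i) (hf i) (hfs i) (hf0 i) M κ hMc hM1).toLp _, fun _ => MemLp.coeFn_toLp _⟩

end Model

end Summit.HodgeConjecture.HodgeConjecture.Cruxes.H413.K2E1PseudoEisensteinTwoTermGramLettersAxisGeneric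

end
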